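import Literature.MathematicalPhysics.KineticTheory.LangevinChainConfinedKalman
import Literature.MathematicalPhysics.KineticTheory.LangevinChainScalingLimit
import Literature.MathematicalPhysics.KineticTheory.PureQuarticEnergy
import HarnessLib

/-!
# The purely quartic chain: a forced equilibrium with all bonds stretched, and Kalman's condition there

Topic `Literature/MathematicalPhysics/KineticTheory` (trunk T-KINETIC). Proof file of the provefact
unit for `CuneoEckmannHairerReyBellet2018_thm213_pureQuartic` (`PureQuarticChainNESS.lean`):
Cuneo–Eckmann–Hairer–Rey-Bellet 2018, Prop. 3.6 (every compact set is small) for the purely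
quartic chain `pureQuarticChain μ γ = ⟨μq⁴/4, r⁴/4, γ⟩`. The tree's Hörmander-free minorisation
(`ConfinedLocalMinorization.lean`) works at an EQUILIBRIUM of the drift whose linearisation is
controllable from the left bath (Kalman). At the rest point `0` of the purely quartic chain the
linearisation is the free motion of DECOUPLED sites (`U''(0) = V''(0) = 0`): Kalman fails for
`N ≥ 3`. The remedy (consumed by `ConfinedForcedMinorization.lean`: minorisation near a FORCED
equilibrium `Y x⋆ + a v_L = 0`) is to pull the left end of the chain with a constant force: the
chain then rests in a configuration `q⋆` in which EVERY bond is stretched, so that the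
linearisation `(DY(x⋆), v_L)` — a chain of harmonic springs `V''(q⋆_{i+1} - q⋆_i) = 3(q⋆_{i+1} - q⋆_i)² ≠ 0`
— is controllable from the left end. This file constructs `q⋆` and proves Kalman's condition there
(everything PROVED; the real cube root and the equilibrium are the only definitions):

* `OscillatorChain.eq_zero_of_forall_pow_unitP_of_stretched` — **Kalman's condition from the left
  bath at ANY configuration all of whose bonds have `V'' ≠ 0`** (`C²` potentials; the peeling
  argument of `LangevinChainConfinedKalman.lean` verbatim, at a general base point);
* `realCbrt` — the odd cube root on `ℝ` (inverse of the order isomorphism `x ↦ x³`);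
* `pureQuarticRestSeq μ` — the back-substitution recursion from the free right end:
  `Q₀ = 1`, `R₀ = ∛(-μ)`, `Q_{k+1} = Q_k - R_k`, `R_{k+1} = ∛(R_k³ - μ Q_{k+1}³)`; for `μ > 0`,
  `Q_k > 0` and `R_k < 0` (`pureQuarticRestSeq_pos_neg`);
* `pureQuarticForcedRest μ N : Fin N → ℝ`, `q⋆_i = Q_{N-1-i}` — **a forced equilibrium**: the
  interior and right-end forces vanish (`pureQuarticChain_dPotential_forcedRest_eq_zero`), the bond
  stretches are the `R_k ≠ 0` (`pureQuarticForcedRest_sub`), and with the constant control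
  `a⋆ = ∂₀Φ(q⋆)/√(2γT_L)` on the left bath the drift is balanced:
  `Y (q⋆, 0) + a⋆ • v_L = 0` (`pureQuarticChain_drift_forcedRest`);
* `pureQuarticChain_kalman_forcedRest` — **Kalman's condition for `(DY(q⋆, 0), v_L)`**.

## References

* N. Cuneo, J.-P. Eckmann, M. Hairer, L. Rey-Bellet, EJP **23** (2018) no. 55, Prop. 3.6, Cor. 3.4
  (control of the chain through the bath momenta).
* E. D. Sontag, *Mathematical Control Theory* (1998), §3.3 (Kalman's rank condition). [folklore]
-/

noncomputable section

open Filter Topology Set Finset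
open scoped ContDiff

namespace Literature.MathematicalPhysics.KineticTheory.HeatConduction

variable {N : ℕ}

/-! ### Kalman's condition at a stretched configuration -/

namespace OscillatorChain

variable (P : OscillatorChain)

/-- **Kalman's rank condition for the linearised chain from the left bath, at a configuration all
of whose bonds have non-degenerate linearised coupling** (`C²` potentials, `N ≥ 1`,
`V''(q_{j+1} - q_j) ≠ 0` for every bond): if a linear functional `ℓ` annihilates all the vectors
`Aᵏ (0, e₀)`, `A = DY(x)`, then `ℓ = 0` — the chain linearised at `x` is controllable by forcing
the momentum of its left end alone (peeling from the left: the sub-diagonal Hessian entries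
`-V''(q_{j+1} - q_j)` are non-zero). [folklore] -/
theorem eq_zero_of_forall_pow_unitP_of_stretched (hU : ContDiff ℝ 2 P.U) (hV : ContDiff ℝ 2 P.V)
    (hN : 0 < N) (x : PhaseSpace N)
    (hVx : ∀ i j : Fin N, i.val = j.val + 1 → deriv (deriv P.V) (x.1 i - x.1 j) ≠ 0)
    (ℓ : PhaseSpace N →ₗ[ℝ] ℝ)
    (h : ∀ k : ℕ, ℓ (((fderiv ℝ (P.drift N) x) ^ k) (unitP ⟨0, hN⟩)) = 0) :
    ℓ = 0 := by
  set A : PhaseSpace N →L[ℝ] PhaseSpace N := fderiv ℝ (P.drift N) x with hA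
  -- the coefficient sequences
  set c : ℕ → Fin N → ℝ := fun k j => ℓ ((A ^ k) (unitP j)) with hc
  set a : ℕ → Fin N → ℝ := fun k j => ℓ ((A ^ k) (unitQ j)) with ha
  -- the recurrences
  have hpow : ∀ (k : ℕ) (v : PhaseSpace N), (A ^ (k + 1)) v = (A ^ k) (A v) := fun k v => by
    rw [pow_succ]
    rfl
  have hrecP : ∀ k j, c (k + 1) j = a k j - P.γ * bathWeight N j * c k j := by
    intro k j
    simp only [hc, ha]
    rw [hpow, hA, P.fderiv_drift_unitP₂ hU hV N x j, map_sub, map_smul, map_sub,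
      map_smul, smul_eq_mul]
  have hrecQ : ∀ k j, a (k + 1) j = -∑ i, P.hessPotential N i j x.1 * c k i := by
    intro k j
    simp only [hc, ha]
    rw [hpow, hA, P.fderiv_drift_unitQ₂ hU hV N x j, map_neg, map_sum, map_neg,
      map_sum]
    congr 1
    refine Finset.sum_congr rfl fun i _ => ?_
    rw [map_smul, map_smul, smul_eq_mul]
  -- the hypothesis: `c k 0 = 0`
  have hc0 : ∀ k, c k ⟨0, hN⟩ = 0 := h
  -- `a k j = 0` once `c` vanishes at `j`
  have ha_of_c : ∀ j, (∀ k, c k j = 0) → ∀ k, a k j = 0 := by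
    intro j hj k
    have := hrecP k j
    rw [hj (k + 1), hj k] at this
    linarith
  -- peeling induction on the site
  have hpeel : ∀ s : ℕ, ∀ j : Fin N, j.val ≤ s → ∀ k, c k j = 0 := by
    intro s
    induction s with
    | zero =>
      intro j hj k
      have : j = ⟨0, hN⟩ := Fin.ext (Nat.le_zero.mp hj)
      rw [this]
      exact hc0 k
    | succ s ih =>
      intro j hj
      by_cases hj' : j.val ≤ s
      · exact ih j hj'
      · have hjs : j.val = s + 1 := by omega
        have hslt : s < N := by omega
        set j₀ : Fin N := ⟨s, hslt⟩ with hj₀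
        intro k
        have h1 : a (k + 1) j₀ = 0 := ha_of_c j₀ (ih j₀ (by simp [hj₀])) (k + 1)
        rw [hrecQ k j₀] at h1
        have hsum : ∑ i, P.hessPotential N i j₀ x.1 * c k i = P.hessPotential N j j₀ x.1 * c k j := by
          refine Finset.sum_eq_single j (fun i _ hij => ?_) (by simp)
          by_cases his : i.val ≤ s
          · rw [ih i his k, mul_zero]
          · have hfar : j₀.val + 2 ≤ i.val := by
              have : i.val ≠ s + 1 := fun e => hij (Fin.ext (by rw [e, hjs]))
              simp only [hj₀]
              omega
            rw [P.hessPotential_eq_zero_of_le N hfar, zero_mul]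
        have hjj₀ : j.val = j₀.val + 1 := by rw [hjs]
        rw [hsum, P.hessPotential_succ N hjj₀, neg_mul, neg_neg] at h1
        exact (mul_eq_zero.1 h1).resolve_left (hVx j j₀ hjj₀)
  have hcall : ∀ j k, c k j = 0 := fun j k => hpeel j.val j le_rfl k
  have haall : ∀ j k, a k j = 0 := fun j => ha_of_c j fun k => hcall j k
  -- conclude on the basis
  refine LinearMap.ext fun v => ?_
  rw [eq_sum_unitQ_add_sum_unitP v, map_add, map_sum, map_sum]
  simp only [map_smul, smul_eq_mul, LinearMap.zero_apply]
  have hQ : ∀ i, ℓ (unitQ i) = 0 := fun i => by simpa [ha] using haall i 0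
  have hP' : ∀ i, ℓ (unitP i) = 0 := fun i => by simpa [hc] using hcall i 0
  simp [hQ, hP']

end OscillatorChain

/-! ### The odd cube root on `ℝ` -/

/-- `x ↦ x³` is strictly increasing on `ℝ`. [folklore] -/
theorem pow_three_strictMono : StrictMono fun x : ℝ => x ^ 3 :=
  Odd.strictMono_pow ⟨1, by norm_num⟩

/-- `x ↦ x³` is onto `ℝ`. [folklore] -/
theorem pow_three_surjective : Function.Surjective fun x : ℝ => x ^ 3 := by
  refine (continuous_pow 3).surjective (tendsto_pow_atTop three_ne_zero) ?_
  have h : Tendsto (fun x : ℝ => -((-x) ^ 3)) atBot atBot :=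
    tendsto_neg_atTop_atBot.comp ((tendsto_pow_atTop three_ne_zero).comp tendsto_neg_atBot_atTop)
  refine h.congr fun x => ?_
  rw [Odd.neg_pow ⟨1, by norm_num⟩, neg_neg]

/-- The order isomorphism `x ↦ x³` of `ℝ`. [folklore] -/
def cubeOrderIso : ℝ ≃o ℝ := pow_three_strictMono.orderIsoOfSurjective _ pow_three_surjective

/-- **The real (odd) cube root** `∛y`: the inverse of `x ↦ x³` on all of `ℝ`. [folklore] -/
def realCbrt (y : ℝ) : ℝ := cubeOrderIso.symm y

/-- `(∛y)³ = y`. [folklore] -/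
@[simp] theorem realCbrt_pow_three (y : ℝ) : realCbrt y ^ 3 = y := by
  have h := cubeOrderIso.apply_symm_apply y
  rwa [cubeOrderIso, StrictMono.coe_orderIsoOfSurjective] at h

/-- `∛(x³) = x`. [folklore] -/
@[simp] theorem realCbrt_of_pow_three (x : ℝ) : realCbrt (x ^ 3) = x := by
  have h := cubeOrderIso.symm_apply_apply x
  rw [cubeOrderIso, StrictMono.coe_orderIsoOfSurjective] at h
  exact h

/-- `∛0 = 0`. [folklore] -/
@[simp] theorem realCbrt_zero : realCbrt 0 = 0 := by
  have h := realCbrt_of_pow_three 0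
  simpa using h

/-- The cube root is strictly increasing. [folklore] -/
theorem realCbrt_strictMono : StrictMono realCbrt := cubeOrderIso.symm.strictMono

/-- `∛y < 0 ↔ y < 0`. [folklore] -/
theorem realCbrt_neg_iff {y : ℝ} : realCbrt y < 0 ↔ y < 0 := by
  have h := realCbrt_strictMono.lt_iff_lt (a := y) (b := 0)
  rwa [realCbrt_zero] at h

/-- The cube root is continuous. [folklore] -/
theorem continuous_realCbrt : Continuous realCbrt := cubeOrderIso.symm.continuous

/-! ### The back-substitution recursion and the forced rest configuration -/

/-- **The rest recursion of the purely quartic chain pulled at its left end**, started at the free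
right end with `q_{N-1} = 1`: `(Q₀, R₀) = (1, ∛(-μ))` and
`(Q_{k+1}, R_{k+1}) = (Q_k - R_k, ∛(R_k³ - μ (Q_k - R_k)³))`; `Q_k` is the position of the site at
distance `k` from the right end and `R_k` the stretch of the bond to its left (the equilibrium
equations `μq_i³ + (q_i - q_{i-1})³ - (q_{i+1} - q_i)³ = 0` of the unforced sites solved for the
left stretch). [folklore] -/
def pureQuarticRestSeq (μ : ℝ) : ℕ → ℝ × ℝ
  | 0 => (1, realCbrt (-μ))
  | k + 1 =>
    ((pureQuarticRestSeq μ k).1 - (pureQuarticRestSeq μ k).2,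
      realCbrt ((pureQuarticRestSeq μ k).2 ^ 3 -
        μ * ((pureQuarticRestSeq μ k).1 - (pureQuarticRestSeq μ k).2) ^ 3))

/-- Unfolding the recursion at `0`. [folklore] -/
theorem pureQuarticRestSeq_zero (μ : ℝ) : pureQuarticRestSeq μ 0 = (1, realCbrt (-μ)) := rfl

/-- The position recursion `Q_{k+1} = Q_k - R_k`. [folklore] -/
theorem pureQuarticRestSeq_succ_fst (μ : ℝ) (k : ℕ) :
    (pureQuarticRestSeq μ (k + 1)).1 = (pureQuarticRestSeq μ k).1 - (pureQuarticRestSeq μ k).2 := rfl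

/-- The stretch recursion cubed: `R_{k+1}³ = R_k³ - μ Q_{k+1}³`. [folklore] -/
theorem pureQuarticRestSeq_succ_snd_pow (μ : ℝ) (k : ℕ) :
    (pureQuarticRestSeq μ (k + 1)).2 ^ 3 =
      (pureQuarticRestSeq μ k).2 ^ 3 - μ * (pureQuarticRestSeq μ (k + 1)).1 ^ 3 := by
  show (realCbrt _) ^ 3 = _
  rw [realCbrt_pow_three]
  rfl

/-- The first stretch cubed: `R₀³ = -μ = -μQ₀³`. [folklore] -/
theorem pureQuarticRestSeq_zero_snd_pow (μ : ℝ) : (pureQuarticRestSeq μ 0).2 ^ 3 = -μ := by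
  show (realCbrt (-μ)) ^ 3 = -μ
  exact realCbrt_pow_three _

/-- **Signs along the recursion** (`μ > 0`): `Q_k > 0` and `R_k < 0` for every `k` — the
positions are positive and increase strictly towards the pulled (left) end, so every bond is
stretched. [folklore] -/
theorem pureQuarticRestSeq_pos_neg {μ : ℝ} (hμ : 0 < μ) (k : ℕ) :
    0 < (pureQuarticRestSeq μ k).1 ∧ (pureQuarticRestSeq μ k).2 < 0 := by
  induction k with
  | zero =>
    refine ⟨by rw [pureQuarticRestSeq_zero]; exact one_pos, ?_⟩
    rw [pureQuarticRestSeq_zero]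
    exact realCbrt_neg_iff.2 (by linarith)
  | succ k ih =>
    obtain ⟨hQ, hR⟩ := ih
    have hQ' : 0 < (pureQuarticRestSeq μ (k + 1)).1 := by
      rw [pureQuarticRestSeq_succ_fst]; linarith
    refine ⟨hQ', ?_⟩
    show realCbrt _ < 0
    rw [realCbrt_neg_iff]
    have h1 : (pureQuarticRestSeq μ k).2 ^ 3 < 0 := Odd.pow_neg ⟨1, by norm_num⟩ hR
    have h2 : 0 < μ * ((pureQuarticRestSeq μ k).1 - (pureQuarticRestSeq μ k).2) ^ 3 := by
      have : 0 < (pureQuarticRestSeq μ k).1 - (pureQuarticRestSeq μ k).2 := by linarith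
      positivity
    linarith

/-- **The forced rest configuration** `q⋆_i = Q_{N-1-i}` of the purely quartic chain of length `N`
pulled at its left end. [folklore] -/
def pureQuarticForcedRest (μ : ℝ) (N : ℕ) : Fin N → ℝ := fun i => (pureQuarticRestSeq μ (N - 1 - i.val)).1

/-- **The bond stretches of the forced rest configuration are the `R_k`**: for `i = j + 1`,
`q⋆_i - q⋆_j = R_{N-1-i}`. [folklore] -/
theorem pureQuarticForcedRest_sub (μ : ℝ) {i j : Fin N} (h : i.val = j.val + 1) :
    pureQuarticForcedRest μ N i - pureQuarticForcedRest μ N j =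
      (pureQuarticRestSeq μ (N - 1 - i.val)).2 := by
  unfold pureQuarticForcedRest
  have hj : N - 1 - j.val = (N - 1 - i.val) + 1 := by have := i.isLt; omega
  rw [hj, pureQuarticRestSeq_succ_fst]
  ring

/-- Every bond of the forced rest configuration is stretched: `q⋆_i ≠ q⋆_j` for `i = j + 1`
(`μ > 0`). [folklore] -/
theorem pureQuarticForcedRest_sub_ne_zero {μ : ℝ} (hμ : 0 < μ) {i j : Fin N} (h : i.val = j.val + 1) :
    pureQuarticForcedRest μ N i - pureQuarticForcedRest μ N j ≠ 0 := by
  rw [pureQuarticForcedRest_sub μ h]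
  exact (pureQuarticRestSeq_pos_neg hμ _).2.ne

/-- **The unforced sites are at rest**: `∂_iΦ(q⋆) = 0` for every site `i ≠ 0` of the purely
quartic chain (`∂_iΦ(q) = μq_i³ + (q_i - q_{i-1})³ - (q_{i+1} - q_i)³`, boundary terms absent at
the ends). [folklore] -/
theorem pureQuarticChain_dPotential_forcedRest_eq_zero (μ γ : ℝ) (i : Fin N) (hi : i.val ≠ 0) :
    (pureQuarticChain μ γ).dPotential N i (pureQuarticForcedRest μ N) = 0 := by
  rw [(pureQuarticChain μ γ).dPotential_eq_closed N i, pureQuarticChain_deriv_U]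
  simp only [pureQuarticChain_deriv_V]
  have hi0 : 0 < i.val := Nat.pos_of_ne_zero hi
  rw [dif_pos hi0]
  set n := N - 1 - i.val with hn
  have hqi : pureQuarticForcedRest μ N i = (pureQuarticRestSeq μ n).1 := rfl
  -- the left bond
  have hleft : pureQuarticForcedRest μ N i - pureQuarticForcedRest μ N ⟨i.val - 1, by omega⟩ =
      (pureQuarticRestSeq μ n).2 :=
    pureQuarticForcedRest_sub μ (by simp; omega)
  rw [hleft]
  by_cases hlast : i.val + 1 < N
  · -- an interior site: `μQ_n³ + R_n³ - R_{n-1}³ = 0` with `n ≥ 1`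
    rw [dif_pos hlast]
    obtain ⟨m, hm⟩ : ∃ m, n = m + 1 := ⟨n - 1, by omega⟩
    have hright : pureQuarticForcedRest μ N ⟨i.val + 1, hlast⟩ - pureQuarticForcedRest μ N i =
        (pureQuarticRestSeq μ m).2 := by
      rw [pureQuarticForcedRest_sub μ (i := ⟨i.val + 1, hlast⟩) (j := i) rfl]
      have hidx : N - 1 - (i.val + 1) = m := by omega
      simp only [hidx]
    rw [hright, hqi, hm, pureQuarticRestSeq_succ_snd_pow]
    ring
  · -- the right end (`n = 0`): `μQ₀³ + R₀³ = μ - μ = 0`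
    rw [dif_neg hlast, hqi]
    have hn0 : n = 0 := by omega
    rw [hn0, pureQuarticRestSeq_zero_snd_pow, pureQuarticRestSeq_zero]
    ring

/-! ### The forced equilibrium of the Langevin drift and Kalman's condition -/

section Forced

variable {μ γ : ℝ} (T_L : ℝ)

/-- The constant control balancing the left-end force at the forced rest configuration:
`a⋆ = ∂₀Φ(q⋆) / √(2γT_L)`. [folklore] -/
def pureQuarticForcedControl (μ γ : ℝ) (N : ℕ) (hN : 0 < N) (T_L : ℝ) : ℝ :=
  (pureQuarticChain μ γ).dPotential N ⟨0, hN⟩ (pureQuarticForcedRest μ N) / Real.sqrt (2 * γ * T_L)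

/-- **The forced rest point is a forced equilibrium of the Langevin drift**:
`Y(q⋆, 0) + a⋆ • v_L = 0` with `v_L = √(2γT_L) ∂_{p_0}` the left bath direction and
`a⋆ = ∂₀Φ(q⋆)/√(2γT_L)` (`γ, T_L > 0`): zero momenta, balanced forces at every site.
[cite: CuneoEckmannHairerReyBellet2018, Cor 3.4] -/
theorem pureQuarticChain_drift_forcedRest (hγ : 0 < γ) (hN : 0 < N) (hTL : 0 < T_L) :
    (pureQuarticChain μ γ).drift N ((pureQuarticForcedRest μ N, 0) : PhaseSpace N) +
      pureQuarticForcedControl μ γ N hN T_L • (pureQuarticChain μ γ).bathVecL N T_L = 0 := by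
  set P := pureQuarticChain μ γ with hP
  have hσ : Real.sqrt (2 * P.γ * T_L) ≠ 0 := by
    rw [hP, pureQuarticChain_γ]; exact Real.sqrt_ne_zero'.2 (by positivity)
  rw [P.drift_eq ((pureQuarticChain_contDiff_U μ γ (n := 1)).differentiable one_ne_zero)
    ((pureQuarticChain_contDiff_V μ γ (n := 1)).differentiable one_ne_zero)]
  ext i
  · simp [OscillatorChain.bathVecL, bathVec]
  · simp only [Prod.snd_add, Prod.smul_snd, OscillatorChain.bathVecL, bathVec, Pi.add_apply,
      Pi.smul_apply, Pi.zero_apply, mul_zero, sub_zero, smul_eq_mul, mul_ite, Prod.snd_zero]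
    by_cases hi : i.val = 0
    · rw [if_pos hi]
      have hi' : i = ⟨0, hN⟩ := Fin.ext hi
      subst hi'
      rw [pureQuarticForcedControl, hP, pureQuarticChain_γ]
      rw [hP, pureQuarticChain_γ] at hσ
      field_simp
      ring
    · rw [if_neg hi, pureQuarticChain_dPotential_forcedRest_eq_zero μ γ i hi]
      ring

/-- **Kalman's condition at the forced equilibrium of the purely quartic chain** (`μ, γ, T_L > 0`,
`N ≥ 1`): a linear functional annihilating all `Aᵏ v_L`, `A = DY(q⋆, 0)`, vanishes — every bond
of `q⋆` is stretched, so `V''(q⋆_{j+1} - q⋆_j) = 3(q⋆_{j+1} - q⋆_j)² ≠ 0` and the peeling argument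
applies. [folklore] -/
theorem pureQuarticChain_kalman_forcedRest (hμ : 0 < μ) (hγ : 0 < γ) (hN : 0 < N) (hTL : 0 < T_L)
    (ℓ : PhaseSpace N →ₗ[ℝ] ℝ)
    (h : ∀ k : ℕ, ℓ (((fderiv ℝ ((pureQuarticChain μ γ).drift N)
      ((pureQuarticForcedRest μ N, 0) : PhaseSpace N)) ^ k) ((pureQuarticChain μ γ).bathVecL N T_L)) = 0) :
    ℓ = 0 := by
  set P := pureQuarticChain μ γ with hP
  set x : PhaseSpace N := (pureQuarticForcedRest μ N, 0) with hx
  have hcL : Real.sqrt (2 * P.γ * T_L) ≠ 0 := by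
    rw [hP, pureQuarticChain_γ]; exact Real.sqrt_ne_zero'.2 (by positivity)
  have hbL : P.bathVecL N T_L = Real.sqrt (2 * P.γ * T_L) • unitP ⟨0, hN⟩ := by
    rw [OscillatorChain.bathVecL, bathVec_eq_smul_unitP hN]
  have hV2 : ∀ r, deriv (deriv P.V) r = 3 * r ^ 2 := by
    intro r
    have h1 : deriv P.V = fun r => r ^ 3 := funext (pureQuarticChain_deriv_V μ γ)
    rw [h1]
    have h : HasDerivAt (fun r : ℝ => r ^ 3) (↑(3 : ℕ) * r ^ (3 - 1)) r := hasDerivAt_pow 3 r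
    rw [h.deriv]; norm_num
  refine P.eq_zero_of_forall_pow_unitP_of_stretched
    ((pureQuarticChain_contDiff_U μ γ).of_le (by norm_cast))
    ((pureQuarticChain_contDiff_V μ γ).of_le (by norm_cast)) hN x (fun i j hij => ?_) ℓ fun k => ?_
  · rw [hV2]
    have hne : x.1 i - x.1 j ≠ 0 := pureQuarticForcedRest_sub_ne_zero hμ hij
    positivity
  · have hk := h k
    rw [hbL, map_smul, LinearMap.map_smul, smul_eq_mul] at hk
    exact (mul_eq_zero.1 hk).resolve_left hcL

/-- **The energy grows at most linearly along the control direction**: for the purely quartic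
chain (`μ ≥ 0`), `DH(y)·(a v_L) ≤ |a|√(2γT_L) (H(y) + 1)` (`DH(y)·(0, e) = ∑ p_i e_i` and
`|p_0| ≤ p_0²/2 + 1/2 ≤ H + 1`) — the hypothesis `hgrow` of `ConfinedForcedMinorization.lean` for
the confined drift of the chain (energy `H`, constant `c = 1`). [folklore] -/
theorem pureQuarticChain_fderiv_hamiltonian_bathVecL_le (hμ : 0 ≤ μ) (hN : 0 < N)
    (a : ℝ) (y : PhaseSpace N) :
    fderiv ℝ ((pureQuarticChain μ γ).hamiltonian N) y (a • (pureQuarticChain μ γ).bathVecL N T_L) ≤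
      |a| * Real.sqrt (2 * γ * T_L) * ((pureQuarticChain μ γ).hamiltonian N y + 1) := by
  set P := pureQuarticChain μ γ with hP
  have hH : Differentiable ℝ (P.hamiltonian N) :=
    (pureQuarticChain_contDiff_hamiltonian μ γ N (n := 1)).differentiable one_ne_zero
  rw [map_smul, smul_eq_mul, P.fderiv_hamiltonian_apply hH]
  have hsum : ∑ i, (partialQ i (P.hamiltonian N) y * (P.bathVecL N T_L).1 i +
      y.2 i * (P.bathVecL N T_L).2 i) = y.2 ⟨0, hN⟩ * Real.sqrt (2 * γ * T_L) := by
    simp only [OscillatorChain.bathVecL, bathVec, Pi.zero_apply, mul_zero, zero_add, mul_ite,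
      hP, pureQuarticChain_γ]
    rw [Finset.sum_ite, Finset.sum_const_zero, add_zero]
    have : Finset.univ.filter (fun i : Fin N => i.val = 0) = {⟨0, hN⟩} := by
      ext i; simp [Fin.ext_iff]
    rw [this, Finset.sum_singleton]
  rw [hsum]
  have hp : |y.2 ⟨0, hN⟩| ≤ P.hamiltonian N y + 1 := by
    have h1 := P.site_le_hamiltonian (pureQuarticChain_U_nonneg hμ γ) (pureQuarticChain_V_nonneg μ γ) N y ⟨0, hN⟩
    have h2 : 0 ≤ P.U (y.1 ⟨0, hN⟩) := pureQuarticChain_U_nonneg hμ γ _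
    have h3 : |y.2 ⟨0, hN⟩| ≤ y.2 ⟨0, hN⟩ ^ 2 / 2 + 1 / 2 := by
      have := abs_le_half_add_sq_half (y.2 ⟨0, hN⟩)
      nlinarith [sq_abs (y.2 ⟨0, hN⟩), sq_nonneg (|y.2 ⟨0, hN⟩| - 1)]
    linarith
  have hs : 0 ≤ Real.sqrt (2 * γ * T_L) := Real.sqrt_nonneg _
  calc a * (y.2 ⟨0, hN⟩ * Real.sqrt (2 * γ * T_L)) = (a * y.2 ⟨0, hN⟩) * Real.sqrt (2 * γ * T_L) := by ring
    _ ≤ |a * y.2 ⟨0, hN⟩| * Real.sqrt (2 * γ * T_L) := mul_le_mul_of_nonneg_right (le_abs_self _) hs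
    _ = |a| * |y.2 ⟨0, hN⟩| * Real.sqrt (2 * γ * T_L) := by rw [abs_mul]
    _ ≤ |a| * (P.hamiltonian N y + 1) * Real.sqrt (2 * γ * T_L) :=
        mul_le_mul_of_nonneg_right (mul_le_mul_of_nonneg_left hp (abs_nonneg a)) hs
    _ = |a| * Real.sqrt (2 * γ * T_L) * (P.hamiltonian N y + 1) := by ring

end Forced

end Literature.MathematicalPhysics.KineticTheory.HeatConduction

end
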